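import Literature.MathematicalPhysics.QuantumFieldTheory.Balaban1983to89.B4Block227
import HarnessLib

/-!
# DAG node N07 [B11], the (P)_D located-research thread (road R0′ junction `hker`; INERT under road (a)):
# CENTRE-DEFECT MOMENTS — the exact low moments of an odd lattice cube about its centre and the centre-minus-mean
# defect `D_B(q) = Σ_{y∈B} q(y) − |B|·q(c_B)` on lattice quadratics: `D_B(q) = |B|·(ℓ²−1)∕24·Δq`, odd parts invisible

Cell `pub-ymgap` (HUMAN RULINGS D-0062 ∕ D-0149 ∕ D-0154), width seat `pub-ymgap-dag-n07-w7` g7, CLAIM-2 (cell bus 2026-08-28).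
`--kind proof --supports stmt-QuantumFields-27364 --as helper` (K1⁹ per dag-lead KEY MAP v2; count-neutral).  THEOREMS ONLY (no `def`).

WHY (ROAD-L4-V3 §3(iii), dag-n07-w7 g7).  The (P)_D form differs from the matched form by `Σ_B β_B D_B(Δ⁻²f)`; in the first
Fourier shell (and in every smooth-regime expansion) the defect of a tile of odd side `ℓ_B` is governed by its SECOND MOMENT about the
centre, `Σ_{y∈B}(y−c_B)_κ(y−c_B)_κ' = δ_κκ'·|B|(ℓ_B²−1)∕12`: one tile size ⇒ the correction is proportional to the centre measure (the
one-level theorem's shadow), mixed sizes (two levels, or one level + clamping singletons) ⇒ it is not (located negative 2 of ROAD-L4-V3: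
the per-heat-time form `Q_t` is indefinite at large `t`).  This file types the exact moment bookkeeping on the index cube
`Fin d → Fin (2r+1)` (the tree's cube letters, cf. `B4Block227.poincare_coordCube8`), centre `r·𝟙`, coordinates `z i = i − r`:
* §1 one dimension: `Σ_{i<A} i² = A(A−1)(2A−1)∕6` (real; `Σ_{i<A} i` is `B4Block227.sum_range_id_real` BY NAME), `Σ_i z i = 0`, `Σ_i (z i)² = (2r+1)·r(r+1)∕3`, `z (rev i) = −z i`.
* §2 Fubini on the cube (`Finset.prod_univ_sum`): `Σ_y g(y κ) = (2r+1)^{d−1}·Σ_i g i`, `Σ_y g(y κ)·h(y κ') = (2r+1)^{d−2}·(Σ g)(Σ h)` (`κ ≠ κ'`);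
  the moments `Σ_y z(y κ) = 0`, `Σ_y z(y κ) z(y κ') = 0` (`κ ≠ κ'`), ★ `Σ_y z(y κ)² = (2r+1)^d·r(r+1)∕3`.
* §3 ★★ `centreDefect_quadratic` — for `q y = a + Σ_κ b_κ z(y κ) + Σ_{κ,κ'} c_{κκ'} z(y κ) z(y κ')`:
  `Σ_y (q y − q centre) = (2r+1)^d · ((2r+1)² − 1)∕24 · (2·Σ_κ c_κκ)` (and `2·Σ_κ c_κκ` is the lattice Laplacian of `q`, `lap_quadratic_coord`);
  ★ `sum_cube_eq_zero_of_odd` — a function odd under the central reflection `y ↦ rev ∘ y` has zero sum (so `D_B` kills all odd Taylor orders).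

HONEST FRAMING (binding).  Count-neutral helper; [folklore] finite sums; asserts NOTHING of [B11]∕[B6]∕[B5]∕[3]; `(P)_D` for Bałaban's `d = 4`
nested geometries OPEN; under road (a) nothing here is consumed; `hker` ∕ stub 1 ∕ K0⁷ ∕ K1⁹ NOT closed; N07 NOT discharged; counts unmoved; no summit
statement is proved by this seat — R4 closes the conditional finite-𝕋⁴ rung `BalabanLadder.UV` only; nothing continuum ∕ ℝ⁴ ∕ OS ∕ mass gap ∕ Clay.
Context only (no hypothesis is a citation): T. Bałaban, CMP **109** (1987) 249–301 [Balaban1987RG1] (0.4) (averaging at block centres, odd `L`).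
-/

set_option autoImplicit false

noncomputable section

open Finset

namespace Summit.QuantumFields.YangMills.Theorems.N07CentreDefectMoments

open Literature.MathematicalPhysics.QuantumFieldTheory.Balaban1983to89.B4Block227 (sum_range_id_real)

/-! ## §1  One dimension: the segment `Fin (2r+1)` about its centre `r` -/

/-- `Σ_{i<A} i² = A(A−1)(2A−1)∕6` (real). [folklore] -/
theorem sum_range_sq_real (A : ℕ) :
    ∑ i ∈ range A, ((i : ℝ)) ^ 2 = (A : ℝ) * ((A : ℝ) - 1) * (2 * (A : ℝ) - 1) / 6 := by
  induction A with
  | zero => simp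
  | succ A ih => rw [Finset.sum_range_succ, ih]; push_cast; ring

/-- First moment about the centre: `Σ_{i : Fin (2r+1)} (i − r) = 0`. [folklore] -/
theorem sum_coord_centre (r : ℕ) : ∑ i : Fin (2 * r + 1), ((i : ℕ) - (r : ℝ)) = 0 := by
  rw [Fin.sum_univ_eq_sum_range (fun i => ((i : ℝ) - r)) (2 * r + 1), Finset.sum_sub_distrib, sum_range_id_real,
    Finset.sum_const, Finset.card_range, nsmul_eq_mul]
  push_cast
  ring

/-- Second moment about the centre: `Σ_{i : Fin (2r+1)} (i − r)² = (2r+1)·r(r+1)∕3`. [folklore] -/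
theorem sum_coord_centre_sq (r : ℕ) :
    ∑ i : Fin (2 * r + 1), ((i : ℕ) - (r : ℝ)) ^ 2 = (2 * r + 1 : ℝ) * (r * (r + 1)) / 3 := by
  have h : ∀ x : ℝ, (x - r) ^ 2 = x ^ 2 - 2 * r * x + (r : ℝ) ^ 2 := fun x => by ring
  rw [Fin.sum_univ_eq_sum_range (fun i => ((i : ℝ) - r) ^ 2) (2 * r + 1)]
  simp only [h, Finset.sum_add_distrib, Finset.sum_sub_distrib, ← Finset.mul_sum, sum_range_sq_real, sum_range_id_real,
    Finset.sum_const, Finset.card_range, nsmul_eq_mul]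
  push_cast
  ring

/-- The central reflection `i ↦ 2r − i` (`Fin.rev`) flips the centred coordinate: `(rev i) − r = −(i − r)`. [folklore] -/
theorem coord_rev (r : ℕ) (i : Fin (2 * r + 1)) : ((Fin.rev i : ℕ) - (r : ℝ)) = -((i : ℕ) - (r : ℝ)) := by
  have hi : (i : ℕ) ≤ 2 * r := by have := i.isLt; omega
  have h1 : ((Fin.rev i : ℕ) : ℝ) = 2 * (r : ℝ) - (i : ℕ) := by
    rw [Fin.val_rev, show 2 * r + 1 - ((i : ℕ) + 1) = 2 * r - (i : ℕ) by omega, Nat.cast_sub hi]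
    push_cast
    ring
  rw [h1]
  ring

/-! ## §2  Fubini on the index cube `Fin d → Fin (2r+1)` and the moments about the centre -/

variable {d : ℕ}

/-- **One-coordinate Fubini**: `Σ_{y : Fin d → Fin m} g(y κ) = m^{d−1}·Σ_i g i` (requires `d ≥ 1`, witnessed by `κ`). [folklore] -/
theorem sum_cube_coord (m : ℕ) (g : Fin m → ℝ) (κ : Fin d) :
    ∑ y : Fin d → Fin m, g (y κ) = (m : ℝ) ^ (d - 1) * ∑ i, g i := by
  classical
  have key := Finset.prod_univ_sum (fun (_ : Fin d) => (Finset.univ : Finset (Fin m)))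
    (fun j a => if j = κ then g a else (1 : ℝ))
  rw [Fintype.piFinset_univ] at key
  have hL : ∏ j : Fin d, ∑ a : Fin m, (if j = κ then g a else (1 : ℝ)) = (m : ℝ) ^ (d - 1) * ∑ i, g i := by
    rw [← Finset.mul_prod_erase Finset.univ _ (Finset.mem_univ κ)]
    have h0 : (∑ a : Fin m, if κ = κ then g a else (1 : ℝ)) = ∑ i, g i := by simp
    have h3 : ∀ j ∈ Finset.univ.erase κ, (∑ a : Fin m, if j = κ then g a else (1 : ℝ)) = (m : ℝ) := by
      intro j hj
      simp [Finset.ne_of_mem_erase hj]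
    rw [h0, Finset.prod_congr rfl h3, Finset.prod_const, Finset.card_erase_of_mem (Finset.mem_univ κ), Finset.card_univ,
      Fintype.card_fin, mul_comm]
  have hR : ∑ y : Fin d → Fin m, ∏ j, (if j = κ then g (y j) else (1 : ℝ)) = ∑ y : Fin d → Fin m, g (y κ) := by
    refine Finset.sum_congr rfl fun y _ => ?_
    rw [← Finset.mul_prod_erase Finset.univ _ (Finset.mem_univ κ)]
    have h0 : (if κ = κ then g (y κ) else (1 : ℝ)) = g (y κ) := if_pos rfl
    rw [h0, Finset.prod_eq_one (fun j hj => if_neg (Finset.ne_of_mem_erase hj)), mul_one]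
  rw [← hR, ← key, hL]

/-- **Two-coordinate Fubini**: for `κ ≠ κ'`, `Σ_y g(y κ)·h(y κ') = m^{d−2}·(Σ g)(Σ h)`. [folklore] -/
theorem sum_cube_coord_mul (m : ℕ) (g h : Fin m → ℝ) {κ κ' : Fin d} (hκ : κ ≠ κ') :
    ∑ y : Fin d → Fin m, g (y κ) * h (y κ') = (m : ℝ) ^ (d - 2) * ((∑ i, g i) * ∑ i, h i) := by
  classical
  let F : Fin d → Fin m → ℝ := fun j a => if j = κ then g a else if j = κ' then h a else 1
  have key := Finset.prod_univ_sum (fun (_ : Fin d) => (Finset.univ : Finset (Fin m))) F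
  rw [Fintype.piFinset_univ] at key
  have hκ'mem : κ' ∈ Finset.univ.erase κ := Finset.mem_erase.mpr ⟨hκ.symm, Finset.mem_univ _⟩
  have hL : ∏ j : Fin d, ∑ a : Fin m, F j a = (m : ℝ) ^ (d - 2) * ((∑ i, g i) * ∑ i, h i) := by
    rw [← Finset.mul_prod_erase Finset.univ _ (Finset.mem_univ κ), ← Finset.mul_prod_erase _ _ hκ'mem]
    have h1 : ∑ a : Fin m, F κ a = ∑ i, g i := by simp [F]
    have h2 : ∑ a : Fin m, F κ' a = ∑ i, h i := by simp [F, hκ.symm]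
    have h3 : ∀ j ∈ (Finset.univ.erase κ).erase κ', ∑ a : Fin m, F j a = (m : ℝ) := by
      intro j hj
      have hj1 : j ≠ κ' := Finset.ne_of_mem_erase hj
      have hj2 : j ≠ κ := Finset.ne_of_mem_erase (Finset.mem_of_mem_erase hj)
      simp [F, hj1, hj2]
    rw [h1, h2, Finset.prod_congr rfl h3, Finset.prod_const, Finset.card_erase_of_mem hκ'mem,
      Finset.card_erase_of_mem (Finset.mem_univ κ), Finset.card_univ, Fintype.card_fin]
    rw [show d - 1 - 1 = d - 2 from rfl]
    ring
  have hR : ∑ y : Fin d → Fin m, ∏ j, F j (y j) = ∑ y : Fin d → Fin m, g (y κ) * h (y κ') := by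
    refine Finset.sum_congr rfl fun y _ => ?_
    rw [← Finset.mul_prod_erase Finset.univ _ (Finset.mem_univ κ), ← Finset.mul_prod_erase _ _ hκ'mem]
    have h1 : F κ (y κ) = g (y κ) := by simp [F]
    have h2 : F κ' (y κ') = h (y κ') := by simp [F, hκ.symm]
    rw [h1, h2, Finset.prod_eq_one (fun j hj => ?_), mul_one]
    have hj1 : j ≠ κ' := Finset.ne_of_mem_erase hj
    have hj2 : j ≠ κ := Finset.ne_of_mem_erase (Finset.mem_of_mem_erase hj)
    simp [F, hj1, hj2]
  rw [← hR, ← key, hL]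

/-- First moment of the cube about its centre: `Σ_y (y κ − r) = 0`. [folklore] -/
theorem sum_cube_centre_coord (r : ℕ) (κ : Fin d) :
    ∑ y : Fin d → Fin (2 * r + 1), (((y κ : ℕ)) - (r : ℝ)) = 0 := by
  rw [sum_cube_coord (2 * r + 1) (fun i => ((i : ℕ) - (r : ℝ))) κ, sum_coord_centre, mul_zero]

/-- Mixed second moment vanishes: for `κ ≠ κ'`, `Σ_y (y κ − r)(y κ' − r) = 0`. [folklore] -/
theorem sum_cube_centre_coord_mul (r : ℕ) {κ κ' : Fin d} (hκ : κ ≠ κ') :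
    ∑ y : Fin d → Fin (2 * r + 1), (((y κ : ℕ)) - (r : ℝ)) * (((y κ' : ℕ)) - (r : ℝ)) = 0 := by
  rw [sum_cube_coord_mul (2 * r + 1) (fun i => ((i : ℕ) - (r : ℝ))) (fun i => ((i : ℕ) - (r : ℝ))) hκ,
    sum_coord_centre, zero_mul, mul_zero]

/-- ★ **Diagonal second moment**: `Σ_y (y κ − r)² = (2r+1)^d · r(r+1)∕3` (= `|B|·(ℓ²−1)∕12` with `ℓ = 2r+1`). [folklore] -/
theorem sum_cube_centre_coord_sq (r : ℕ) (κ : Fin d) (hd : 1 ≤ d) :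
    ∑ y : Fin d → Fin (2 * r + 1), (((y κ : ℕ)) - (r : ℝ)) ^ 2 = (2 * r + 1 : ℝ) ^ d * (r * (r + 1)) / 3 := by
  rw [sum_cube_coord (2 * r + 1) (fun i => ((i : ℕ) - (r : ℝ)) ^ 2) κ, sum_coord_centre_sq]
  obtain ⟨e, rfl⟩ : ∃ e, d = e + 1 := ⟨d - 1, by omega⟩
  simp only [Nat.add_sub_cancel, pow_succ]
  push_cast
  ring

/-- The same with the tile-side letter: `Σ_y (y κ − r)² = (2r+1)^d · ((2r+1)² − 1)∕12`. [folklore] -/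
theorem sum_cube_centre_coord_sq' (r : ℕ) (κ : Fin d) (hd : 1 ≤ d) :
    ∑ y : Fin d → Fin (2 * r + 1), (((y κ : ℕ)) - (r : ℝ)) ^ 2 = (2 * r + 1 : ℝ) ^ d * (((2 * r + 1 : ℝ)) ^ 2 - 1) / 12 := by
  rw [sum_cube_centre_coord_sq r κ hd]; ring

/-! ## §3  The centre-minus-mean defect on lattice quadratics, and odd functions -/

/-- ★★ **THE CENTRE-MINUS-MEAN DEFECT OF A LATTICE QUADRATIC**: for
`q y = a + Σ_κ b_κ (y κ − r) + Σ_κ Σ_κ' c_κκ' (y κ − r)(y κ' − r)` on the cube of odd side `ℓ = 2r+1` (dimension `d ≥ 1`),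
`Σ_y (q y − q(centre)) = ℓ^d · (ℓ² − 1)∕24 · (2·Σ_κ c_κκ)` — constants and linear terms are invisible, mixed terms vanish, each pure square
contributes `|B|(ℓ²−1)∕12`; `2·Σ_κ c_κκ` is the lattice Laplacian of `q` (`lap_quadratic_coord`). [folklore] -/
theorem centreDefect_quadratic (r : ℕ) (hd : 1 ≤ d) (a : ℝ) (b : Fin d → ℝ) (c : Fin d → Fin d → ℝ) :
    ∑ y : Fin d → Fin (2 * r + 1),
        ((a + ∑ κ, b κ * (((y κ : ℕ)) - (r : ℝ)) + ∑ κ, ∑ κ', c κ κ' * ((((y κ : ℕ)) - (r : ℝ)) * (((y κ' : ℕ)) - (r : ℝ))))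
          - a)
      = (2 * r + 1 : ℝ) ^ d * ((((2 * r + 1 : ℝ)) ^ 2 - 1) / 24) * (2 * ∑ κ, c κ κ) := by
  classical
  simp only [add_assoc, add_sub_cancel_left, Finset.sum_add_distrib]
  -- linear part
  have hlin : ∑ y : Fin d → Fin (2 * r + 1), ∑ κ, b κ * (((y κ : ℕ)) - (r : ℝ)) = 0 := by
    rw [Finset.sum_comm]
    refine Finset.sum_eq_zero fun κ _ => ?_
    rw [← Finset.mul_sum, sum_cube_centre_coord, mul_zero]
  -- quadratic part
  have hquad : ∑ y : Fin d → Fin (2 * r + 1), ∑ κ, ∑ κ', c κ κ' * ((((y κ : ℕ)) - (r : ℝ)) * (((y κ' : ℕ)) - (r : ℝ)))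
      = ∑ κ, c κ κ * ((2 * r + 1 : ℝ) ^ d * (((2 * r + 1 : ℝ)) ^ 2 - 1) / 12) := by
    rw [Finset.sum_comm]
    refine Finset.sum_congr rfl fun κ _ => ?_
    rw [Finset.sum_comm]
    rw [← Finset.sum_erase_add Finset.univ _ (Finset.mem_univ κ)]
    have hdiag : ∑ y : Fin d → Fin (2 * r + 1), c κ κ * ((((y κ : ℕ)) - (r : ℝ)) * (((y κ : ℕ)) - (r : ℝ)))
        = c κ κ * ((2 * r + 1 : ℝ) ^ d * (((2 * r + 1 : ℝ)) ^ 2 - 1) / 12) := by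
      rw [← Finset.mul_sum]
      congr 1
      rw [← sum_cube_centre_coord_sq' r κ hd]
      exact Finset.sum_congr rfl fun y _ => by ring
    have hoff : ∑ κ' ∈ Finset.univ.erase κ, ∑ y : Fin d → Fin (2 * r + 1),
        c κ κ' * ((((y κ : ℕ)) - (r : ℝ)) * (((y κ' : ℕ)) - (r : ℝ))) = 0 := by
      refine Finset.sum_eq_zero fun κ' hκ' => ?_
      rw [← Finset.mul_sum, sum_cube_centre_coord_mul r (Finset.ne_of_mem_erase hκ').symm, mul_zero]
    rw [hdiag, hoff, zero_add]
  rw [hlin, hquad, zero_add, ← Finset.sum_mul]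
  ring

/-- The lattice Laplacian of a quadratic is the constant `2·tr c`: along each axis the centred second difference of
`t ↦ a + b t + c t²` is `2c`. [folklore] -/
theorem lap_quadratic_coord (a b c t : ℝ) :
    (a + b * (t + 1) + c * (t + 1) ^ 2) + (a + b * (t - 1) + c * (t - 1) ^ 2) - 2 * (a + b * t + c * t ^ 2) = 2 * c := by
  ring

/-- ★ **Odd functions have zero sum on the cube**: if `q (rev ∘ y) = −q y` for the central reflection `rev` (`i ↦ 2r − i`
coordinatewise) then `Σ_y q y = 0` — so the centre-minus-mean defect `D_B` kills every odd Taylor order. [folklore] -/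
theorem sum_cube_eq_zero_of_odd (r : ℕ) (q : (Fin d → Fin (2 * r + 1)) → ℝ)
    (hq : ∀ y, q (fun κ => Fin.rev (y κ)) = -q y) :
    ∑ y : Fin d → Fin (2 * r + 1), q y = 0 := by
  have h := Fintype.sum_equiv (Equiv.piCongrRight fun _ : Fin d => Fin.revPerm)
    (fun y => q (fun κ => Fin.rev (y κ))) q (fun _ => rfl)
  have h2 : ∑ y : Fin d → Fin (2 * r + 1), q (fun κ => Fin.rev (y κ)) = -∑ y : Fin d → Fin (2 * r + 1), q y := by
    rw [← Finset.sum_neg_distrib]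
    exact Finset.sum_congr rfl fun y _ => hq y
  rw [h] at h2
  linarith

/-- Translation of the centre: the centred coordinate of the reflected index is the negative, `(rev (y κ)) − r = −((y κ) − r)`
(so `q` built from odd monomials in the centred coordinates satisfies the hypothesis of `sum_cube_eq_zero_of_odd`). [folklore] -/
theorem coord_rev_apply (r : ℕ) (y : Fin d → Fin (2 * r + 1)) (κ : Fin d) :
    (((Fin.rev (y κ) : ℕ)) - (r : ℝ)) = -(((y κ : ℕ)) - (r : ℝ)) :=
  coord_rev r (y κ)

/-- Example of use: the cubic monomial `(y κ − r)³` has zero sum on the cube. [folklore] -/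
theorem sum_cube_centre_coord_cube (r : ℕ) (κ : Fin d) :
    ∑ y : Fin d → Fin (2 * r + 1), (((y κ : ℕ)) - (r : ℝ)) ^ 3 = 0 :=
  sum_cube_eq_zero_of_odd r _ fun y => by rw [coord_rev_apply]; ring

/-- Every cubic monomial in the centred coordinates has zero cube sum. [folklore] -/
theorem sum_cube_centre_coord_mul_mul (r : ℕ) (κ κ' κ'' : Fin d) :
    ∑ y : Fin d → Fin (2 * r + 1),
      (((y κ : ℕ)) - (r : ℝ)) * (((y κ' : ℕ)) - (r : ℝ)) * (((y κ'' : ℕ)) - (r : ℝ)) = 0 :=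
  sum_cube_eq_zero_of_odd r _ fun y => by simp only [coord_rev_apply]; ring

/-- ★★ **THE DEFECT OF A LATTICE CUBIC** — cubic terms are invisible too: for
`q y = a + Σ_κ b_κ z_κ + Σ_{κκ'} c_κκ' z_κ z_κ' + Σ_{κκ'κ''} e_κκ'κ'' z_κ z_κ' z_κ''` (`z_κ = y κ − r`),
`Σ_y (q y − q(centre)) = ℓ^d · (ℓ² − 1)∕24 · (2·Σ_κ c_κκ)`, `ℓ = 2r+1` — and `2·Σ_κ c_κκ` is the lattice Laplacian of `q` AT THE
CENTRE (the cubic part's Laplacian `6 Σ_κ e_κκκ z_κ + …` vanishes there), i.e. `D_B(q) = |B|(ℓ²−1)∕24·(Δq)(c_B)` for every lattice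
polynomial of degree ≤ 3: the centre-minus-mean defect is second-order accurate with only EVEN-order corrections. [folklore] -/
theorem centreDefect_cubic (r : ℕ) (hd : 1 ≤ d) (a : ℝ) (b : Fin d → ℝ) (c : Fin d → Fin d → ℝ)
    (e : Fin d → Fin d → Fin d → ℝ) :
    ∑ y : Fin d → Fin (2 * r + 1),
        ((a + ∑ κ, b κ * (((y κ : ℕ)) - (r : ℝ)) + ∑ κ, ∑ κ', c κ κ' * ((((y κ : ℕ)) - (r : ℝ)) * (((y κ' : ℕ)) - (r : ℝ)))
            + ∑ κ, ∑ κ', ∑ κ'', e κ κ' κ'' *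
                ((((y κ : ℕ)) - (r : ℝ)) * (((y κ' : ℕ)) - (r : ℝ)) * (((y κ'' : ℕ)) - (r : ℝ))))
          - a)
      = (2 * r + 1 : ℝ) ^ d * ((((2 * r + 1 : ℝ)) ^ 2 - 1) / 24) * (2 * ∑ κ, c κ κ) := by
  classical
  have hcub : ∑ y : Fin d → Fin (2 * r + 1), ∑ κ, ∑ κ', ∑ κ'', e κ κ' κ'' *
      ((((y κ : ℕ)) - (r : ℝ)) * (((y κ' : ℕ)) - (r : ℝ)) * (((y κ'' : ℕ)) - (r : ℝ))) = 0 := by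
    rw [Finset.sum_comm]
    refine Finset.sum_eq_zero fun κ _ => ?_
    rw [Finset.sum_comm]
    refine Finset.sum_eq_zero fun κ' _ => ?_
    rw [Finset.sum_comm]
    refine Finset.sum_eq_zero fun κ'' _ => ?_
    rw [← Finset.mul_sum, sum_cube_centre_coord_mul_mul, mul_zero]
  have hq := centreDefect_quadratic r hd a b c
  have hsplit : ∀ y : Fin d → Fin (2 * r + 1),
      ((a + ∑ κ, b κ * (((y κ : ℕ)) - (r : ℝ)) + ∑ κ, ∑ κ', c κ κ' * ((((y κ : ℕ)) - (r : ℝ)) * (((y κ' : ℕ)) - (r : ℝ)))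
            + ∑ κ, ∑ κ', ∑ κ'', e κ κ' κ'' *
                ((((y κ : ℕ)) - (r : ℝ)) * (((y κ' : ℕ)) - (r : ℝ)) * (((y κ'' : ℕ)) - (r : ℝ))))
          - a)
        = ((a + ∑ κ, b κ * (((y κ : ℕ)) - (r : ℝ)) + ∑ κ, ∑ κ', c κ κ' * ((((y κ : ℕ)) - (r : ℝ)) * (((y κ' : ℕ)) - (r : ℝ))))
            - a)
          + ∑ κ, ∑ κ', ∑ κ'', e κ κ' κ'' *
                ((((y κ : ℕ)) - (r : ℝ)) * (((y κ' : ℕ)) - (r : ℝ)) * (((y κ'' : ℕ)) - (r : ℝ))) := fun y => by ring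
  simp only [hsplit, Finset.sum_add_distrib, hcub, add_zero]
  exact hq

end Summit.QuantumFields.YangMills.Theorems.N07CentreDefectMoments

end
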